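import Summits.CriticalPhenomena.PercolationContinuityZ3.Theorems.PercNearOneGluingNoHeavyLowerTailSahiHittingSlot
import Summits.CriticalPhenomena.PercolationContinuityZ3.Theorems.PercNearOneGluingNoHeavyLowerTailSahiCombStrata

/-!
# `NoHeavyLowerTail` (crux stmt-CriticalPhenomena-4575), Sahi / Kahn positivity: INTERSECTING THE FIRST SLOT WITH AN INDEPENDENT CYLINDER

Support file (cell `prim-l12`, seat P3, gen 3; `--supports stmt-CriticalPhenomena-4575`).  No `sorry`, no definitions, no named facts, standard axioms.

**Transfer identity** (`sahiE_three_cylinder_inter_eq`).  For a cylinder `P = {ω | S ⊆ ω}`, an event `H` ignoring `S` (`H^{S←1} = H`) and any `U, V`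
(`X^S := {ω | ω ∪ S ∈ X}` the `S ↦ 1` section, `μ = μ_p`):
  `E₃(1_{P∩H}, 1_U, 1_V) = μ(P)·[ E₃(1_H, 1_{U^S}, 1_{V^S}) + μ(H)·(μ(U^S∩V^S) − μ(U∩V)) + (μU^S − μU)·Cov(H,V^S) + (μV^S − μV)·Cov(H,U^S)`
  `                                + μ(H)·(μU^S − μU)(μV^S − μV) ]`
— for increasing `H, U, V` every correction term is ≥ 0 (Harris, monotonicity of sections).  Hence (`sahiE_three_cylinder_inter_nonneg_of_forall`):
if `E₃(1_H, 1_{U'}, 1_{V'}) ≥ 0` for ALL increasing `U', V'`, then `E₃(1_{P∩H}, 1_U, 1_V) ≥ 0` for all increasing `U, V` — the class of admissible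
first slots (against two arbitrary increasing events) is closed under intersection with an independent cylinder.  With `…SahiHittingSlot`:
(`sahiE_three_cylinder_inter_hit_nonneg`) `E₃(1_{P ∩ H_B}, 1_U, 1_V) ≥ 0` for every cylinder `P = {S ⊆ ω}`, every hitting event `H_B`, `B ∩ S = ∅`,
and ALL increasing `U, V` — Kahn's Conjecture 5 for the first slot "all of `S` and some of `B` open" (e.g. `C_a ∩ (C_b ∪ C_c)`, one of the three
first-slot types on three coordinates beyond cylinders and hitting events; the extension-principle census of `…SahiJuntaSlotExtension`). [this work]
-/

noncomputable section

open scoped Classical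

namespace Summit.CriticalPhenomena.PercolationContinuityZ3.Theorems

namespace SahiHittingSlot

open Finset
open Literature.Combinatorics.Sahi2008
open Literature.Probability.Percolation.BHK2006 (ind_inter)
open Literature.Probability.Percolation.DecisionTree (ind ind_of_mem ind_of_not_mem ind_nonneg)
open SahiComb

variable {ι : Type} [Fintype ι]

/-- Conditioning on a cylinder: `E[1_P · 1_X] = μ(P) · μ(X^{S←1})`, `P = {S ⊆ ω}`. [folklore] -/
theorem pr_cylinder_inter (p : ι → unitInterval) (S : Set ι) (X : Set (Set ι)) :
    pr p ({ω : Set ι | S ⊆ ω} ∩ X) = pr p {ω : Set ι | S ⊆ ω} * pr p (secUnion S X) := by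
  have hprod : ind ({ω : Set ι | S ⊆ ω} ∩ X) = ind X * ind {ω : Set ι | S ⊆ ω} := by
    funext ω; rw [Pi.mul_apply, ind_inter, mul_comm]
  rw [pr, hprod, ex_ind_mul_ind_cylinder_eq, ex_ind_freeze_eq_secUnion, ← ex_ind_cylinder_eq_prod]; rfl

/-- **The transfer identity.**  For the cylinder `P = {S ⊆ ω}`, an event `H` with `H^{S←1} = H` and any `U, V`:
`E₃(1_{P∩H},1_U,1_V) = μ(P)·[E₃(1_H,1_{U^S},1_{V^S}) + μH(μ(U^SV^S) − μ(UV)) + (μU^S−μU)Cov(H,V^S) + (μV^S−μV)Cov(H,U^S) + μH(μU^S−μU)(μV^S−μV)]`.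
[this work] -/
theorem sahiE_three_cylinder_inter_eq (p : ι → unitInterval) (S : Set ι) {H : Set (Set ι)} (hH : secUnion S H = H) (U V : Set (Set ι)) :
    sahiE (bernoulliWeight p) 3 ![ind ({ω : Set ι | S ⊆ ω} ∩ H), ind U, ind V] =
      pr p {ω : Set ι | S ⊆ ω} *
        (sahiE (bernoulliWeight p) 3 ![ind H, ind (secUnion S U), ind (secUnion S V)]
          + pr p H * (pr p (secUnion S U ∩ secUnion S V) - pr p (U ∩ V))
          + (pr p (secUnion S U) - pr p U) * (pr p (H ∩ secUnion S V) - pr p H * pr p (secUnion S V))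
          + (pr p (secUnion S V) - pr p V) * (pr p (H ∩ secUnion S U) - pr p H * pr p (secUnion S U))
          + pr p H * ((pr p (secUnion S U) - pr p U) * (pr p (secUnion S V) - pr p V))) := by
  have hprod : ∀ X Y : Set (Set ι), ind X * ind Y = ind (X ∩ Y) := fun X Y => funext fun ω => (ind_inter X Y ω).symm
  rw [sahiE_three, sahiE_three]
  simp only [hprod]
  change 2 * pr p ({ω : Set ι | S ⊆ ω} ∩ H ∩ U ∩ V) + pr p ({ω : Set ι | S ⊆ ω} ∩ H) * pr p U * pr p V
      - (pr p ({ω : Set ι | S ⊆ ω} ∩ H) * pr p (U ∩ V) + pr p U * pr p ({ω : Set ι | S ⊆ ω} ∩ H ∩ V)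
        + pr p V * pr p ({ω : Set ι | S ⊆ ω} ∩ H ∩ U)) =
    pr p {ω : Set ι | S ⊆ ω} *
      (2 * pr p (H ∩ secUnion S U ∩ secUnion S V) + pr p H * pr p (secUnion S U) * pr p (secUnion S V)
        - (pr p H * pr p (secUnion S U ∩ secUnion S V) + pr p (secUnion S U) * pr p (H ∩ secUnion S V)
          + pr p (secUnion S V) * pr p (H ∩ secUnion S U))
        + pr p H * (pr p (secUnion S U ∩ secUnion S V) - pr p (U ∩ V))
        + (pr p (secUnion S U) - pr p U) * (pr p (H ∩ secUnion S V) - pr p H * pr p (secUnion S V))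
        + (pr p (secUnion S V) - pr p V) * (pr p (H ∩ secUnion S U) - pr p H * pr p (secUnion S U))
        + pr p H * ((pr p (secUnion S U) - pr p U) * (pr p (secUnion S V) - pr p V)))
  rw [Set.inter_assoc, Set.inter_assoc, pr_cylinder_inter, secUnion_inter, secUnion_inter, hH, pr_cylinder_inter, hH,
    Set.inter_assoc, pr_cylinder_inter, secUnion_inter, hH, Set.inter_assoc, pr_cylinder_inter, secUnion_inter, hH, ← Set.inter_assoc]
  ring

/-- **Cylinder transfer of first-slot positivity.**  If `E₃(1_H, 1_{U'}, 1_{V'}) ≥ 0` for all increasing `U', V'` (the increasing event `H` ignoring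
`S`), then `E₃(1_{P∩H}, 1_U, 1_V) ≥ 0` for all increasing `U, V`, `P = {S ⊆ ω}`. [this work] -/
theorem sahiE_three_cylinder_inter_nonneg_of_forall (p : ι → unitInterval) (S : Set ι) {H : Set (Set ι)} (hHu : IsUpperSet H)
    (hH : secUnion S H = H)
    (hpos : ∀ U' V' : Set (Set ι), IsUpperSet U' → IsUpperSet V' → 0 ≤ sahiE (bernoulliWeight p) 3 ![ind H, ind U', ind V'])
    {U V : Set (Set ι)} (hU : IsUpperSet U) (hV : IsUpperSet V) :
    0 ≤ sahiE (bernoulliWeight p) 3 ![ind ({ω : Set ι | S ⊆ ω} ∩ H), ind U, ind V] := by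
  rw [sahiE_three_cylinder_inter_eq p S hH U V]
  have hUS := isUpperSet_secUnion S hU
  have hVS := isUpperSet_secUnion S hV
  have h1 := hpos _ _ hUS hVS
  have h2 : 0 ≤ pr p (secUnion S U ∩ secUnion S V) - pr p (U ∩ V) := by
    rw [← secUnion_inter]; exact sub_nonneg.2 (pr_mono p (subset_secUnion S (hU.inter hV)))
  have hdU : 0 ≤ pr p (secUnion S U) - pr p U := sub_nonneg.2 (pr_mono p (subset_secUnion S hU))
  have hdV : 0 ≤ pr p (secUnion S V) - pr p V := sub_nonneg.2 (pr_mono p (subset_secUnion S hV))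
  have hcV : 0 ≤ pr p (H ∩ secUnion S V) - pr p H * pr p (secUnion S V) := cov_nonneg p hHu hVS
  have hcU : 0 ≤ pr p (H ∩ secUnion S U) - pr p H * pr p (secUnion S U) := cov_nonneg p hHu hUS
  have hH0 : 0 ≤ pr p H := pr_nonneg p H
  have hP0 : 0 ≤ pr p {ω : Set ι | S ⊆ ω} := pr_nonneg p _
  exact mul_nonneg hP0 (by nlinarith [mul_nonneg hdU hcV, mul_nonneg hdV hcU, mul_nonneg hH0 (mul_nonneg hdU hdV), mul_nonneg hH0 h2])

omit [Fintype ι] in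
/-- A hitting event on coordinates disjoint from `S` ignores `S`. [folklore] -/
theorem secUnion_hitSet_eq {S : Set ι} {B : Finset ι} (hB : ∀ b ∈ B, b ∉ S) :
    secUnion S {ω : Set ι | ∃ a ∈ B, a ∈ ω} = {ω : Set ι | ∃ a ∈ B, a ∈ ω} := by
  ext ω
  simp only [mem_secUnion, Set.mem_setOf_eq, Set.mem_union]
  constructor
  · rintro ⟨a, ha, (haω | haS)⟩
    · exact ⟨a, ha, haω⟩
    · exact (hB a ha haS).elim
  · rintro ⟨a, ha, haω⟩; exact ⟨a, ha, Or.inl haω⟩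

/-- **Kahn's Conjecture 5 for the first slot "all of `S` open and some of `B` open"** (`S ∩ B = ∅`): for every cylinder `P = {S ⊆ ω}`, hitting event
`H_B`, and ALL increasing `U, V`: `E₃(1_{P ∩ H_B}, 1_U, 1_V) ≥ 0`. [this work] -/
theorem sahiE_three_cylinder_inter_hit_nonneg (p : ι → unitInterval) (S : Set ι) (B : Finset ι) (hB : ∀ b ∈ B, b ∉ S)
    {U V : Set (Set ι)} (hU : IsUpperSet U) (hV : IsUpperSet V) :
    0 ≤ sahiE (bernoulliWeight p) 3 ![ind ({ω : Set ι | S ⊆ ω} ∩ {ω : Set ι | ∃ a ∈ B, a ∈ ω}), ind U, ind V] :=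
  sahiE_three_cylinder_inter_nonneg_of_forall p S (isUpperSet_hit B) (secUnion_hitSet_eq hB)
    (fun _ _ hU' hV' => sahiE_three_hit_nonneg p B hU' hV') hU hV

end SahiHittingSlot

end Summit.CriticalPhenomena.PercolationContinuityZ3.Theorems
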